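import Summits.Langlands.Langlands.Theorems.RationalPeriodQuarterPeriodClassNontrivialOfBLZ
import Literature.NumberTheory.Automorphic.BLZPeriodCocycleAnalyticityProofs
import Literature.NumberTheory.Automorphic.BLZPeriodCocycleSingularitiesProofs

/-!
# `PeriodClassNontrivialQuarter` from BLZ Proposition 5.1 alone

Route `Langlands/RationalPeriodQuarter`, crux `PeriodClassNontrivialQuarter` (stmt-Langlands-2805). Of the three
Bruggeman–Lewis–Zagier named facts used by the bridge `periodClassNontrivialQuarter_of_BLZ`
(`RationalPeriodQuarterPeriodClassNontrivialOfBLZ.lean`), two are discharged by light-weight Literature proof files: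
`BruggemanLewisZagier2015_cocycle_analytic_holds` (`BLZPeriodCocycleAnalyticityProofs`, `r_γ ∈ V_s^ω`, p. 29) and
`BruggemanLewisZagier2015_singularities_invariants_holds` (`BLZPeriodCocycleSingularitiesProofs`, `S_s^Γ = {0}`,
§13.1 p. 83). This file records the crux conditionally on the remaining fact, BLZ Proposition 5.1 (injectivity of
`r : E_s^Γ → H¹(Γ; V_s^ω)`, p. 30) — itself proved in `BLZPeriodCocycleInjectivity` (sibling file
`RationalPeriodQuarterPeriodClassNontrivial.lean` applies it) — and, unconditionally, piece A of the g39 node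
`AnalyticCoboundarySplit`: the typed Lewis–Zagier cocycle of a quarter cusp form is real-analytic on `ℝ`.

References: [BruggemanLewisZagier2015] R. Bruggeman, J. Lewis, D. Zagier, *Period functions for Maass wave forms and
cohomology*, Mem. AMS 237 no. 1118 (2015), doi:10.1090/memo/1118 — (5.5a) p. 29, Prop. 5.1 p. 30, §13.1 p. 83.
-/

noncomputable section

set_option linter.dupNamespace false

namespace Summit.Langlands.Langlands.Theorems

open Literature.NumberTheory.Automorphic

/-- **`PeriodClassNontrivialQuarter` from BLZ Proposition 5.1** (the facts of p. 29 and p. 83 being theorems of the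
tree). [cite: BruggemanLewisZagier2015, Proposition 5.1 p. 30] -/
theorem periodClassNontrivialQuarter_of_prop51 (hA : BruggemanLewisZagier2015_prop_5_1) :
    Summit.Langlands.Langlands.Theses.RationalPeriodQuarter.PeriodClassNontrivialQuarter :=
  periodClassNontrivialQuarter_of_BLZ BruggemanLewisZagier2015_cocycle_analytic_holds hA
    BruggemanLewisZagier2015_singularities_invariants_holds

/-- **Piece A of the g39 node, unconditionally:** for a quarter cusp form `u` on `Γ₁(N)` and `γ ∈ Γ₁(N)` the typed
cocycle `t ↦ lzCocycle u γ t` is real-analytic on all of `ℝ` (`r_γ ∈ V_{1/2}^ω`).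
[cite: BruggemanLewisZagier2015, (5.5a) p. 29] -/
theorem cocycleAnalyticity_statement :
    (let IsQuarterCuspForm : ℕ → (UpperHalfPlane → ℂ) → Prop := fun N u => Literature.NumberTheory.Automorphic.IsC2 u ∧ (∀ γ ∈ CongruenceSubgroup.Gamma1 N, ∀ z : UpperHalfPlane, u (γ • z) = u z) ∧ (∀ z : UpperHalfPlane, Literature.NumberTheory.Automorphic.hypLaplacian u z + (1 / 4 : ℂ) * u z = 0) ∧ ∃ C : ℝ, ∀ z : UpperHalfPlane, ‖u z‖ ≤ C; let lzCocycle : (UpperHalfPlane → ℂ) → Matrix.SpecialLinearGroup (Fin 2) ℤ → ℝ → ℂ := fun u γ t => ∫ τ in (0 : ℝ)..1, (let w : ℂ := (1 - (τ : ℂ)) * ((γ⁻¹ • UpperHalfPlane.I : UpperHalfPlane) : ℂ) + (τ : ℂ) * Complex.I; let dw : ℂ := Complex.I - ((γ⁻¹ • UpperHalfPlane.I : UpperHalfPlane) : ℂ); (fderiv ℝ (u ∘ UpperHalfPlane.ofComplex) w 1 - Complex.I * fderiv ℝ (u ∘ UpperHalfPlane.ofComplex) w Complex.I) / 2 * ((Real.sqrt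 w.im / ‖w - (t : ℂ)‖ : ℝ) : ℂ) * dw + (u ∘ UpperHalfPlane.ofComplex) w * (((fderiv ℝ (fun x : ℂ => Real.sqrt x.im / ‖x - (t : ℂ)‖) w 1 : ℝ) + Complex.I * (fderiv ℝ (fun x : ℂ => Real.sqrt x.im / ‖x - (t : ℂ)‖) w Complex.I : ℝ)) / 2) * (starRingEnd ℂ) dw); ∀ N : ℕ, 0 < N → ∀ u : UpperHalfPlane → ℂ, IsQuarterCuspForm N u → ∀ γ ∈ CongruenceSubgroup.Gamma1 N, AnalyticOnNhd ℝ (lzCocycle u γ) Set.univ) :=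
  cocycleAnalyticity_of_BLZ BruggemanLewisZagier2015_cocycle_analytic_holds

end Summit.Langlands.Langlands.Theorems
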